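import Summits.QuantumFields.YangMills.Theorems.BalabanUVNodesN12DirectChartLetterCore
import Summits.QuantumFields.YangMills.Theorems.BalabanUVNodesN12RightInverseLevelZeroLocality
import Literature.MathematicalPhysics.QuantumFieldTheory.Balaban1983to89.Node00.MultiScaleFibreChartLocalityComponent
import HarnessLib

/-!
# DAG node N12 [B15] — THE (P4) SUPPORT LETTER OF THE DIRECT ROAD IS MIS-SHAPED: a kernel certificate that the two displayed binders `hHinv` ∧ `hHsupp` of
# `chartRows_direct_of_letters` (p654775 :171 ∕ :173) are JOINTLY UNSATISFIABLE as soon as `0 < k` and one fine bond has its source off `Ω₁(Z)`, and the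
# one-clause repair under which the letter holds for EVERY right inverse

Cell `pub-ymgap` (HUMAN RULINGS D-0062 ∕ D-0149), base `pub-ymgap-dag-n08-c` g53 (an idle SUMMON-only N08 base taking a located CROSS-NODE piece under director-ym №219 (1)
«take a located piece or close clean»): the chair's START-LIST row «N12 (P4) H1-loc + F-multilocal» (INBOX l.41887; director-ym №232; clone `dag-n12-w6` g6 seated 18:15Z) asks for
«LITERALLY the four binders `H`, `hHinv`, `hHB`, `hHsupp` of `chartRows_direct_of_letters`».  This file shows that no such quadruple exists for the instances the road is about
(`Z` with `Ω₁(Z) ≠` the whole torus), names the one `v` the consumer's proof actually needs the support clause for, and proves the repaired clause for every right inverse.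
Key K1⁹ `stmt-QuantumFields-27364`, `--kind proof --supports … --as helper`; count-neutral; THEOREMS ONLY (0 `def`, 0 `sorry`, 0 `instance`, 0 `notation`).

THE OBSERVATION ([III] (2.2) p. 255: `Γ₀ = Ω₁ᶜ`; (2.11) p. 256: `M⁰ = id`).  In the determining set of record `𝐁_k(Z) = Bj M₁ Z k` (`k ≥ 1`) the level-0 rows are exactly the fine bonds
with an end-point outside `Ω₁ = maxDomT M₁ Z 1` (n10-w1 H10 `mem_bondsOf_Bj_zero`), and on the fibre the level-0 component of NODE 00's chart `Ψ = msChart …` at such a bond `c` IS the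
coordinate `X_c` near `0` (dag-n12-w4 g4 `Node00.msChart_apply_levelZero_eventuallyEq` ∕ `Node00.fderiv_msChart_apply_levelZero`: `(DΨ(0)w)(i₀ c) = w c`).  Hence EVERY right inverse
`H` of `DΨ_{U₀}(0)` — a bare function, linear or not, flat or curved background — places the level-0 datum identically: `H v c = v (i₀ c)` (§1).  The displayed support clause
`hHsupp : ∀ v b, b.src ∉ Ω₁ → H v b = 0` then forces `v (i₀ b₀) = 0` for ALL data `v` at any bond `b₀` with `b₀.src ∉ Ω₁` — false at `v := Pi.single (i₀ b₀) e`, `e ≠ 0` in `𝔰𝔲(2)`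
(§2: ★★★ `not_exists_hH_direct`, stated in `chartRows_direct_of_letters`' OWN binders `ν Kt k Z ext Vk U₀ hmin0 hsb`).  So p654775's theorem is vacuous in that regime and the (P4)
socket as worded cannot be served by any construction (H1-loc ∕ F-multilocal or other).

THE REPAIR (§3).  The consumer uses `hHsupp v` once (p654775 :218–:224, inside `hlamv`), and applies `hlamv` at the single datum `v = Ψ₂ w w` (:238).  The level-0 rows of `Ψ` are
LINEAR near `0`, so `Ψ₂ w w′` vanishes on every level-0 row (dag-n12-w4 g4 `Node00.fderiv_fderiv_msChart_apply_levelZero`; ★ `fderiv_fderiv_msChart_levelZeroFree_direct` below, in the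
consumer's binders).  The consistent clause is therefore `hHsupp′ : ∀ v, (v vanishes on the level-0 rows sourced off Ω₁) → ∀ b, b.src ∉ Ω₁ → H v b = 0` — and THAT clause holds for
EVERY right inverse with no construction at all (★★ `hHsupp_levelZeroFree_of_rightInverse`).  With it, (P4) collapses to «a right inverse of `fderiv ℝ Ψ 0` with a letter `B` at the
curved guarded minimiser `U₀`» — n10-w1's module F ∕ H3 (`…N12GuardedLinAvgRightInverseBj.exists_radius_rightInverse_fderiv_msChart_Bj`, §5 `_of_agreeOn`) modulo the near-flat radius
`‖↑U₀ − 1‖ < ρ′` (the gauge step); no per-row support threading is needed for this socket.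

CONSUMED BY NAME, nothing modified: dag-n12-w4's `chartRows_direct_of_letters` binders (p654775) and `Node00.MultiScaleFibreChartLocalityComponent` (g4), n10-w1's H10
`…N12RightInverseLevelZeroLocality.mem_bondsOf_Bj_zero`, n07-w2 ∕ n12-w1's `Node00.differentiableAt_msChart` ∕ `regularity_binders_msChart` (the guard's regularity), r11's `B14.Eq213DetSet.Bj`.

CONTENTS (ns `Summit.QuantumFields.YangMills.BalabanUVNodes.N12DirectChartLetterHSupportVacuity`).
§1 (general `N`, determining set `𝔹`, datum `W`, `U` in the fibre, `Ψ` differentiable at `0`) ★ `rightInverse_apply_levelZero` — `hHinv ⇒ H v c = v (i₀ c)` at every `c ∈ bondsOf (𝔹 0)`;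
   `not_rightInverse_vanishing_at_levelZero` — no right inverse has `H v c = 0` for all `v` at a level-0 row once `𝔰𝔲(N) ≠ 0`; `exists_ne_zero_lieSU_two` (`diag(i, −i)`).
§2 (the record: `𝐁_k(Z)`, `k ≥ 1`) ★★ `not_exists_rightInverse_vanishing_off_Omega1` (general `N`, datum `W`, guard `SmallBelow`) and ★★★ `not_exists_hH_direct` — LITERALLY p654775's binders,
   `N = 2`: `0 < k → b₀.src ∉ maxDomT ν.M₁ Z 1 → ¬ ∃ H, (∀ v, fderiv ℝ Ψ 0 (H v) = v) ∧ (∀ v b, b.src ∉ maxDomT ν.M₁ Z 1 → H v b = 0)`.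
§3 ★★ `hHsupp_levelZeroFree_of_rightInverse` (the repaired clause, every right inverse, general `N` ∕ `W`) and ★ `fderiv_fderiv_msChart_levelZeroFree_direct` (the consumer's one datum
   `Ψ₂ w w′` meets its premise — in p654775's binders).
§4 ★★ `exists_hH_levelZeroFree_of_surjective` — with the repaired clause, (P4) (`H`, `B`, `hHinv`, `hHB`, `hHsupp′`) follows from SURJECTIVITY of `DΨ_U(0)` alone (a linear right inverse,
   `B = √#bonds·C_H`): the socket is dag-n12-w4's `hsurj` at the curved guarded minimiser, i.e. n10-w1 H3 at near-flat `U₀` ∕ the gauge step otherwise.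

HONEST FRAMING.  A located mis-shaped socket and its kernel certificate — bookkeeping over landed theorems ([III] (2.2)∕(2.11) level-0 rows); no estimate of Bałaban's asserted; the repair
wording is the lane owner's (dag-n12-c) call; N12 ∕ N08 NOT discharged; K1⁹ NOT closed; count-neutral (typed 28∕28 · discharged 5∕27 unmoved); one finite 𝕋⁴ programme at fixed ε — R4 closes
the conditional finite-𝕋⁴ rung `BalabanLadder.UV` only; the YM mass gap (Clay) is NOT proved by any of this; nothing continuum ∕ ℝ⁴ ∕ OS.
-/

noncomputable section

open scoped BigOperators Matrix.Norms.L2Operator Topology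
open Filter

namespace Summit.QuantumFields.YangMills.BalabanUVNodes.N12DirectChartLetterHSupportVacuity

open Literature.MathematicalPhysics.QuantumFieldTheory.Balaban1983to89
open T4Continuum (T4Family)
open T4AdjointCovarianceUnitary (lieSU mem_lieSU_iff)
open T4CubeChartGnomonic (SU2)
open B15DeterminingSets GaugeField
open B14.Eq213DetSet (Bj maxDomT)
open Literature.MathematicalPhysics.QuantumFieldTheory.BalabanImbrieJaffe1984to88.BIJ85Eq453GaugeField (qsstarGIter0)
open Node00
open Summit.QuantumFields.YangMills.BalabanUVNodes.N12RightInverseLevelZeroLocality (mem_bondsOf_Bj_zero)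

variable {F : T4Family}

/-! ## §1  Every right inverse of `DΨ_U(0)` places the level-0 datum identically -/

section LevelZero

variable {N : ℕ} [NeZero N] {K k : ℕ} {𝔹 : DetSet (F.P K)} {W : MSField (F.P K) (SU N)} {U : GaugeField (F.P K) 0 (SU N)}

/-- ★ **EVERY RIGHT INVERSE IS THE IDENTITY PLACEMENT ON THE LEVEL-0 ROWS**: for `U` in the fibre of the datum `W` on `𝐁` and NODE 00's chart `Ψ = msChart F N K k 𝐁 W U` differentiable at `0`,
any map `H` (no linearity) with `DΨ(0)(H v) = v` for all `v` satisfies `H v c = v (i₀ c)` at every level-0 constrained bond `c ∈ bondsOf (𝐁 0)`, `i₀ c = constrEnum 𝐁 k (0, c)` — because the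
level-0 row of `DΨ(0)` is the evaluation at `c` (`Node00.fderiv_msChart_apply_levelZero`, [III] (2.11) `M⁰ = id`). [cite: Balaban1988Convergent, (2.2) p.255, (2.11) p.256; Balaban1985Variational, (45) p.285, (83) p.290] -/
theorem rightInverse_apply_levelZero (hU : AgreeOn 𝔹 (avgFamily (avOfRecord F N K) U) W) (hΨ : DifferentiableAt ℝ (msChart F N K k 𝔹 W U) 0)
    (H : (Fin (constrCard 𝔹 k) → lieSU (Fin N)) → PBond (F.P K) 0 → lieSU (Fin N))
    (hHinv : ∀ v, fderiv ℝ (msChart F N K k 𝔹 W U) 0 (H v) = v)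
    (v : Fin (constrCard 𝔹 k) → lieSU (Fin N)) {c : PBond (F.P K) 0} (hc : c ∈ bondsOf (𝔹 0)) :
    H v c = v (constrEnum 𝔹 k ⟨⟨0, Nat.succ_pos k⟩, c, hc⟩) := by
  rw [← fderiv_msChart_apply_levelZero hU hΨ c hc (H v), hHinv v]

/-- **NO RIGHT INVERSE VANISHES IDENTICALLY AT A LEVEL-0 ROW** once `𝔰𝔲(N) ≠ 0`: if `H v c = 0` for every datum `v` at some `c ∈ bondsOf (𝐁 0)`, then `v (i₀ c) = 0` for every `v` — false at
`v := Pi.single (i₀ c) e`, `e ≠ 0`. [cite: Balaban1988Convergent, (2.2) p.255, (2.11) p.256] -/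
theorem not_rightInverse_vanishing_at_levelZero (hU : AgreeOn 𝔹 (avgFamily (avOfRecord F N K) U) W) (hΨ : DifferentiableAt ℝ (msChart F N K k 𝔹 W U) 0)
    (H : (Fin (constrCard 𝔹 k) → lieSU (Fin N)) → PBond (F.P K) 0 → lieSU (Fin N))
    (hHinv : ∀ v, fderiv ℝ (msChart F N K k 𝔹 W U) 0 (H v) = v)
    {c : PBond (F.P K) 0} (hc : c ∈ bondsOf (𝔹 0)) {e : lieSU (Fin N)} (he : e ≠ 0)
    (hzero : ∀ v, H v c = 0) : False := by
  classical
  have h := rightInverse_apply_levelZero hU hΨ H hHinv (Pi.single (constrEnum 𝔹 k ⟨⟨0, Nat.succ_pos k⟩, c, hc⟩) e) hc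
  rw [hzero, Pi.single_eq_same] at h
  exact he h.symm

end LevelZero

/-- `𝔰𝔲(2) ≠ 0`: the diagonal matrix `diag(i, −i)` is a nonzero trace-free skew-Hermitian matrix. [folklore] -/
theorem exists_ne_zero_lieSU_two : ∃ e : lieSU (Fin 2), e ≠ 0 := by
  have hmem : (!![Complex.I, 0; 0, -Complex.I] : Matrix (Fin 2) (Fin 2) ℂ) ∈ lieSU (Fin 2) := by
    rw [mem_lieSU_iff]
    refine ⟨?_, ?_⟩
    · rw [Matrix.star_eq_conjTranspose]
      ext i j
      fin_cases i <;> fin_cases j <;> simp [Matrix.conjTranspose_apply]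
    · rw [Matrix.trace_fin_two_of]
      ring
  refine ⟨⟨_, hmem⟩, fun h => ?_⟩
  have h00 := congrArg (fun e : lieSU (Fin 2) => (e : Matrix (Fin 2) (Fin 2) ℂ) 0 0) h
  simp only [Matrix.of_apply, Matrix.cons_val', Matrix.cons_val_zero, Matrix.cons_val_fin_one, ZeroMemClass.coe_zero,
    Matrix.zero_apply] at h00
  exact Complex.I_ne_zero h00

/-! ## §2  At the determining set of record `𝐁_k(Z)`: the displayed support letter is unsatisfiable -/

section Record

variable {N : ℕ} [NeZero N] {K k : ℕ}

/-- ★★ **NO RIGHT INVERSE OF `DΨ_U(0)` AT `𝐁_k(Z)` VANISHES ON THE BONDS SOURCED OFF `Ω₁`** (general `N` with `𝔰𝔲(N) ≠ 0`, any datum `W` with `U` in its fibre, `U` on the (0.4) guard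
`SmallBelow` below `k`, `k ≥ 1`): one bond `b₀` with `b₀.src ∉ Ω₁ = maxDomT M₁ Z 1` is a level-0 row (H10 `mem_bondsOf_Bj_zero`), where every right inverse is the identity placement (§1).
[cite: Balaban1988Convergent, (2.2) p.255, (2.11) p.256, (2.13) pp.256-257; Balaban1985Variational, (45) p.285] -/
theorem not_exists_rightInverse_vanishing_off_Omega1 {M₁ : ℕ} (hk : 0 < k) {Z : Set (Site (F.P K) 0)} {W : MSField (F.P K) (SU N)} {U : GaugeField (F.P K) 0 (SU N)}
    (hU : AgreeOn (Bj M₁ Z k) (avgFamily (avOfRecord F N K) U) W) (hsb : SmallBelow (avOfRecord F N K) k U)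
    {e : lieSU (Fin N)} (he : e ≠ 0) {b₀ : PBond (F.P K) 0} (hb₀ : b₀.src ∉ maxDomT M₁ Z 1) :
    ¬ ∃ H : (Fin (constrCard (Bj M₁ Z k : DetSet (F.P K)) k) → lieSU (Fin N)) → PBond (F.P K) 0 → lieSU (Fin N),
        (∀ v, fderiv ℝ (msChart F N K k (Bj M₁ Z k) W U) 0 (H v) = v) ∧
        (∀ v (b : PBond (F.P K) 0), b.src ∉ maxDomT M₁ Z 1 → H v b = 0) := by
  rintro ⟨H, hHinv, hHsupp⟩
  exact not_rightInverse_vanishing_at_levelZero hU (differentiableAt_msChart hU hsb) H hHinv ((mem_bondsOf_Bj_zero hk Z b₀).2 (Or.inl hb₀)) he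
    (fun v => hHsupp v b₀ hb₀)

/-- ★★★ **THE (P4) TARGET LETTER AS DISPLAYED IS UNSATISFIABLE** — in `chartRows_direct_of_letters`' OWN binders (p654775: `ν Kt k Z ext Vk U₀`, the minimiser `hmin0` over the class of
record at `𝐁_k(Z)`, the guard `hsb`; `N = 2`): as soon as `0 < k` and ONE fine bond `b₀` has `b₀.src ∉ Ω₁(Z) = maxDomT ν.M₁ Z 1`, there is NO `H` with both `hHinv : ∀ v, DΨ_{U₀}(0)(H v) = v`
(:171) and `hHsupp : ∀ v b, b.src ∉ Ω₁ → H v b = 0` (:173).  Hence the theorem is vacuous in that regime and no (P4) construction can serve the socket as worded.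
[cite: Balaban1988Convergent, (2.2) p.255, (2.11) p.256, (2.13) pp.256-257; Balaban1989LargeFieldII, p.357, (1.12) p.359; Balaban1985Variational, (45) p.285, (83) p.290] -/
theorem not_exists_hH_direct (ν : Node00.Stage7Numerics) (Kt : ℕ) {k : ℕ} (hk : 0 < k)
    (Z : Set (Site (F.P Kt) 0))
    (ext : GaugeField (F.P Kt) k SU2 → GaugeField (F.P Kt) k SU2) (Vk : GaugeField (F.P Kt) k SU2)
    (U₀ : GaugeField (F.P Kt) 0 SU2)
    (hmin0 : IsMinimizer (Node00.avOfRecord F 2 Kt) (Node00.regMSCoPOfRecord F 2 ν Kt k (maxDomT ν.M₁ Z)) (Bj ν.M₁ Z k)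
      (avgFamily (Node00.avOfRecord F 2 Kt) (qsstarGIter0 k (ext Vk))) U₀)
    (hsb : SmallBelow (Node00.avOfRecord F 2 Kt) k U₀)
    {b₀ : PBond (F.P Kt) 0} (hb₀ : b₀.src ∉ maxDomT ν.M₁ Z 1) :
    ¬ ∃ H : (Fin (constrCard (Bj ν.M₁ Z k) k) → lieSU (Fin 2)) → PBond (F.P Kt) 0 → lieSU (Fin 2),
        (∀ v, fderiv ℝ (msChart F 2 Kt k (Bj ν.M₁ Z k) (avgFamily (avOfRecord F 2 Kt) (qsstarGIter0 k (ext Vk))) U₀) 0 (H v) = v) ∧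
        (∀ v (b : PBond (F.P Kt) 0), b.src ∉ maxDomT ν.M₁ Z 1 → H v b = 0) := by
  obtain ⟨e, he⟩ := exists_ne_zero_lieSU_two
  exact not_exists_rightInverse_vanishing_off_Omega1 (F := F) hk hmin0.2.1 hsb he hb₀

end Record

/-! ## §3  The repaired support clause holds for EVERY right inverse; the consumer's one datum is level-0-free -/

section Repair

variable {N : ℕ} [NeZero N] {K k : ℕ}

/-- ★★ **THE REPAIRED SUPPORT LETTER, FOR EVERY RIGHT INVERSE** (general `N`, datum `W`, `U` in its fibre on the guard, `k ≥ 1`): for data `v` vanishing on the level-0 rows `c` with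
`c.src ∉ Ω₁`, every right inverse `H` of `DΨ_U(0)` at `𝐁_k(Z)` has `H v b = 0` at every bond `b` with `b.src ∉ Ω₁` — `H v b = v (i₀ b) = 0` (§1).  No construction, no near-flatness, no letter.
[cite: Balaban1988Convergent, (2.2) p.255, (2.11) p.256, (2.13) pp.256-257; Balaban1985Variational, (45) p.285] -/
theorem hHsupp_levelZeroFree_of_rightInverse {M₁ : ℕ} (hk : 0 < k) {Z : Set (Site (F.P K) 0)} {W : MSField (F.P K) (SU N)} {U : GaugeField (F.P K) 0 (SU N)}
    (hU : AgreeOn (Bj M₁ Z k) (avgFamily (avOfRecord F N K) U) W) (hsb : SmallBelow (avOfRecord F N K) k U)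
    (H : (Fin (constrCard (Bj M₁ Z k : DetSet (F.P K)) k) → lieSU (Fin N)) → PBond (F.P K) 0 → lieSU (Fin N))
    (hHinv : ∀ v, fderiv ℝ (msChart F N K k (Bj M₁ Z k) W U) 0 (H v) = v)
    (v : Fin (constrCard (Bj M₁ Z k : DetSet (F.P K)) k) → lieSU (Fin N))
    (hv : ∀ (c : PBond (F.P K) 0) (hc : c.src ∉ maxDomT M₁ Z 1),
      v (constrEnum (Bj M₁ Z k : DetSet (F.P K)) k ⟨⟨0, Nat.succ_pos k⟩, c, (mem_bondsOf_Bj_zero hk Z c).2 (Or.inl hc)⟩) = 0)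
    (b : PBond (F.P K) 0) (hb : b.src ∉ maxDomT M₁ Z 1) : H v b = 0 :=
  (rightInverse_apply_levelZero hU (differentiableAt_msChart hU hsb) H hHinv v ((mem_bondsOf_Bj_zero hk Z b).2 (Or.inl hb))).trans (hv b hb)

/-- ★ **THE CONSUMER'S ONE DATUM IS LEVEL-0-FREE** — in `chartRows_direct_of_letters`' binders: the second derivative `Ψ₂ = fderiv ℝ (fderiv ℝ Ψ) 0` of the chart of record at the guarded
minimiser `U₀` vanishes on EVERY level-0 row, `(Ψ₂ w w′)(i₀ c) = 0` for `c ∈ bondsOf (𝐁_k(Z) 0)` (dag-n12-w4's `Node00.fderiv_fderiv_msChart_apply_levelZero` with the guard's regularity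
binders) — so the repaired clause applies at the `v = Ψ₂ w w` of p654775 :238. [cite: Balaban1988Convergent, (2.2) p.255, (2.11)–(2.12) p.256; Balaban1985Variational, (81)–(83) p.290; Balaban1989LargeFieldII, (1.12) p.359] -/
theorem fderiv_fderiv_msChart_levelZeroFree_direct (ν : Node00.Stage7Numerics) (Kt : ℕ) {k : ℕ}
    (Z : Set (Site (F.P Kt) 0))
    (ext : GaugeField (F.P Kt) k SU2 → GaugeField (F.P Kt) k SU2) (Vk : GaugeField (F.P Kt) k SU2)
    (U₀ : GaugeField (F.P Kt) 0 SU2)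
    (hmin0 : IsMinimizer (Node00.avOfRecord F 2 Kt) (Node00.regMSCoPOfRecord F 2 ν Kt k (maxDomT ν.M₁ Z)) (Bj ν.M₁ Z k)
      (avgFamily (Node00.avOfRecord F 2 Kt) (qsstarGIter0 k (ext Vk))) U₀)
    (hsb : SmallBelow (Node00.avOfRecord F 2 Kt) k U₀)
    (w w' : PBond (F.P Kt) 0 → lieSU (Fin 2)) (c : PBond (F.P Kt) 0) (hc : c ∈ bondsOf ((Bj ν.M₁ Z k : DetSet (F.P Kt)) 0)) :
    fderiv ℝ (fderiv ℝ (msChart F 2 Kt k (Bj ν.M₁ Z k) (avgFamily (avOfRecord F 2 Kt) (qsstarGIter0 k (ext Vk))) U₀)) 0 w w'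
        (constrEnum (Bj ν.M₁ Z k : DetSet (F.P Kt)) k ⟨⟨0, Nat.succ_pos k⟩, c, hc⟩) = 0 := by
  obtain ⟨hΨ₂, hΨd⟩ := regularity_binders_msChart (k := k) (𝔹 := Bj ν.M₁ Z k) hmin0.2.1 hsb
  exact fderiv_fderiv_msChart_apply_levelZero hmin0.2.1 hΨd hΨ₂.differentiableAt c hc w w'

end Repair

/-! ## §4  With the repaired clause, (P4) IS surjectivity of `DΨ_{U₀}(0)` — nothing about supports -/

section Reduction

open Summit.QuantumFields.YangMills.BalabanUVNodes.N12NearFlatChartLetter (l2Seminorm_le_sqrt_card_mul_norm l2Seminorm_apply)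

variable {N : ℕ} [NeZero N] {K k : ℕ}

/-- ★★ **(P4) UNDER THE REPAIRED LETTER ⟸ SURJECTIVITY** (general `N`, datum `W`, `U` in its fibre on the guard, `k ≥ 1`): if `DΨ_U(0) = fderiv ℝ (msChart F N K k 𝐁_k(Z) W U) 0` is ONTO, there
are a map `H` and a letter `B ≥ 0` with `hHinv : ∀ v, DΨ_U(0)(H v) = v`, `hHB : ∀ v, √(Σ_b ‖H v b‖²) ≤ B‖v‖` and the REPAIRED support clause (`H` = any linear right inverse — finite-dimensional
linear algebra; `B = √#bonds · C_H`, `C_H` a continuity bound of the linear `H`; the clause by §3).  So the (P4) socket, once repaired, is exactly dag-n12-w4 g3's `hsurj` at the curved guarded minimiser — n10-w1 H3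
`surjective_fderiv_msChart_Bj_of_agreeOn` at near-flat `U₀`, the gauge step otherwise; no per-row support threading. [cite: Balaban1985Variational, (45)–(46) p.285, (83) p.290; Balaban1988Convergent, (2.2) p.255, (2.11) p.256] -/
theorem exists_hH_levelZeroFree_of_surjective {M₁ : ℕ} (hk : 0 < k) {Z : Set (Site (F.P K) 0)} {W : MSField (F.P K) (SU N)} {U : GaugeField (F.P K) 0 (SU N)}
    (hU : AgreeOn (Bj M₁ Z k) (avgFamily (avOfRecord F N K) U) W) (hsb : SmallBelow (avOfRecord F N K) k U)
    (hsurj : Function.Surjective (fderiv ℝ (msChart F N K k (Bj M₁ Z k) W U) 0)) :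
    ∃ (H : (Fin (constrCard (Bj M₁ Z k : DetSet (F.P K)) k) → lieSU (Fin N)) → PBond (F.P K) 0 → lieSU (Fin N)) (B : ℝ), 0 ≤ B ∧
      (∀ v, fderiv ℝ (msChart F N K k (Bj M₁ Z k) W U) 0 (H v) = v) ∧
      (∀ v, Real.sqrt (∑ b, ‖H v b‖ ^ 2) ≤ B * ‖v‖) ∧
      (∀ v, (∀ (c : PBond (F.P K) 0) (hc : c.src ∉ maxDomT M₁ Z 1),
          v (constrEnum (Bj M₁ Z k : DetSet (F.P K)) k ⟨⟨0, Nat.succ_pos k⟩, c, (mem_bondsOf_Bj_zero hk Z c).2 (Or.inl hc)⟩) = 0) →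
        ∀ b : PBond (F.P K) 0, b.src ∉ maxDomT M₁ Z 1 → H v b = 0) := by
  set L : (PBond (F.P K) 0 → lieSU (Fin N)) →L[ℝ] (Fin (constrCard (Bj M₁ Z k : DetSet (F.P K)) k) → lieSU (Fin N)) :=
    fderiv ℝ (msChart F N K k (Bj M₁ Z k) W U) 0 with hL
  let Lₗ : (PBond (F.P K) 0 → lieSU (Fin N)) →ₗ[ℝ] (Fin (constrCard (Bj M₁ Z k : DetSet (F.P K)) k) → lieSU (Fin N)) := L.toLinearMap
  have hLₗ : ∀ X, Lₗ X = L X := fun X => rfl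
  have hrange : LinearMap.range Lₗ = ⊤ := LinearMap.range_eq_top.2 (fun v => by obtain ⟨X, hX⟩ := hsurj v; exact ⟨X, (hLₗ X).trans hX⟩)
  obtain ⟨g, hg⟩ := Lₗ.exists_rightInverse_of_surjective hrange
  obtain ⟨C, hC0, hC⟩ := SemilinearMapClass.bound_of_continuous g (LinearMap.continuous_of_finiteDimensional g)
  have hinv : ∀ v, fderiv ℝ (msChart F N K k (Bj M₁ Z k) W U) 0 (g v) = v := fun v => by
    have h := LinearMap.congr_fun hg v
    rw [LinearMap.comp_apply, LinearMap.id_apply, hLₗ] at h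
    exact h
  refine ⟨fun v => g v, Real.sqrt (Fintype.card (PBond (F.P K) 0)) * C, by positivity, hinv, fun v => ?_,
    fun v hv b hb => hHsupp_levelZeroFree_of_rightInverse hk hU hsb (fun v => g v) hinv v hv b hb⟩
  rw [← l2Seminorm_apply (g v)]
  calc (normSeminorm ℝ (PiLp 2 (fun _ : PBond (F.P K) 0 => lieSU (Fin N)))).comp (WithLp.linearEquiv 2 ℝ (PBond (F.P K) 0 → lieSU (Fin N))).symm.toLinearMap (g v)
      ≤ Real.sqrt (Fintype.card (PBond (F.P K) 0)) * ‖g v‖ := l2Seminorm_le_sqrt_card_mul_norm (g v)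
    _ ≤ Real.sqrt (Fintype.card (PBond (F.P K) 0)) * (C * ‖v‖) := mul_le_mul_of_nonneg_left (hC v) (Real.sqrt_nonneg _)
    _ = Real.sqrt (Fintype.card (PBond (F.P K) 0)) * C * ‖v‖ := by ring

end Reduction

end Summit.QuantumFields.YangMills.BalabanUVNodes.N12DirectChartLetterHSupportVacuity

end
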